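import Literature.Computability.AlgebraicComplexity.SymmetricArithCircuit
import Mathlib.Data.Fintype.Sum
import Mathlib.Logic.Embedding.Basic
import Mathlib.Logic.Equiv.Sum
import HarnessLib

/-!
# Symmetric circuits: Hadamard (entrywise) products of two equivariant output families

Topic `Computability/AlgebraicComplexity`, namespace `Literature.Computability.AlgebraicComplexity`.

A closure property of Dawar–Wilsenach symmetric arithmetic circuits
(`SymmetricArithCircuit.lean`: `LabelledArithCircuit` = Def. 2.2, `IsAutomorphismExtending` =
Def. 3.6, `IsSymmetric` = Def. 3.7 of A. Dawar, G. Wilsenach, *Symmetric Arithmetic Circuits*,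
Theory of Computing 21 (2025)): if a `Γ`-symmetric labelled circuit `C` over the constants `K`
and the variables `X` computes two output families `(a_y)_{y ∈ Y}`, `(b_y)_{y ∈ Y}` at outputs
indexed by the `Γ`-set `Y ⊕ Y` (this is how the pairing of two `Γ`-symmetric circuits with
outputs indexed by `Y`, `SymmetricCircuitPairing.lean`, delivers them), then their HADAMARD
(entrywise) product `(a_y · b_y)_{y ∈ Y}` — e.g. `(A_ij · B_ij)_{ij}` for two equivariant
matrices — is computed at outputs indexed by `Y` by a `Γ`-symmetric labelled circuit on exactly
`|G| + |Y|` gates (`LabelledArithCircuit.IsSymmetric.exists_hadamard`). This is one of the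
closure properties behind "products of symmetrically computable families are symmetrically
computable" (Dawar–Wilsenach, remark after Def. 3.7).

Construction (`LabelledArithCircuit.Hadamard.hadCircuit`, a post-composition gadget): gate set
`G ⊕ Y`; an old gate `Sum.inl g` keeps its label and its wires; the new gate `Sum.inr y` is a
multiplication gate whose children are (the copies of) the two output gates of `C` indexed
`Sum.inl y` and `Sum.inr y` — two DISTINCT gates, outputs being injectively indexed (Def. 2.2 with
outputs, Anderson–Dawar Def. 4), so that its value is the binary product `a_y · b_y`
(`eval_output`) — and it is the output gate indexed `y`. No input gate is added, so the clause
"distinct input gates have distinct labels" of Def. 2.2 is inherited from `C`. An automorphism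
`π` of `C` extending `γ` (Def. 3.6) extends as `π ⊕ (γ • ·)` (`Equiv.sumCongr`,
`isAutomorphismExtending_sumCongr`): the children of `Sum.inr (γ • y)` are the images of the
children of `Sum.inr y` because `out (γ • Sum.inl y) = π (out (Sum.inl y))` and
`γ • Sum.inl y = Sum.inl (γ • y)` for the sum action (`Sum.smul_inl`, `Sum.smul_inr`).
Everything is folklore and proved; nothing here is a named fact.
-/

noncomputable section

open scoped Classical

namespace Literature.Computability.AlgebraicComplexity

open MvPolynomial

universe u v w z

namespace LabelledArithCircuit

namespace Hadamard

variable {K : Type u} {X : Type v} {Y : Type z} {G : Type w}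
  (C : LabelledArithCircuit K X (Y ⊕ Y) G)

/-! ### The construction -/

/-- Children in the Hadamard circuit: an old gate keeps its children; the new gate `Sum.inr y`
has the two output gates of `C` indexed `Sum.inl y` and `Sum.inr y` as children.
[cite: DawarWilsenach2025, Def. 2.2] -/
def hadChildren : G ⊕ Y → Finset (G ⊕ Y)
  | .inl g => (C.children g).map Function.Embedding.inl
  | .inr y => {Sum.inl (C.output (Sum.inl y)), Sum.inl (C.output (Sum.inr y))}

/-- Labels in the Hadamard circuit: old gates keep their labels, the new gates are
multiplication gates. [cite: DawarWilsenach2025, Def. 2.2] -/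
def hadLabel : G ⊕ Y → CircuitLabel K X
  | .inl g => C.label g
  | .inr _ => .mul

/-- Children of an old gate. [cite: DawarWilsenach2025, Def. 2.2] -/
theorem hadChildren_inl (g : G) :
    hadChildren C (.inl g) = (C.children g).map Function.Embedding.inl := rfl

/-- Children of a new product gate: the two output gates of `C` indexed `Sum.inl y`, `Sum.inr y`.
[cite: DawarWilsenach2025, Def. 2.2] -/
theorem hadChildren_inr (y : Y) :
    hadChildren C (.inr y) = {Sum.inl (C.output (Sum.inl y)), Sum.inl (C.output (Sum.inr y))} := rfl

/-- Label of an old gate. [cite: DawarWilsenach2025, Def. 2.2] -/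
theorem hadLabel_inl (g : G) : hadLabel C (.inl g) = C.label g := rfl

/-- The new gates are multiplication gates. [cite: DawarWilsenach2025, Def. 2.2] -/
theorem hadLabel_inr (y : Y) : hadLabel C (.inr y) = .mul := rfl

/-- The two children of a new product gate are distinct: distinct output indices designate
distinct gates. [cite: DawarWilsenach2025, Def. 2.2] -/
theorem inl_output_inl_ne (y : Y) :
    (Sum.inl (C.output (Sum.inl y)) : G ⊕ Y) ≠ Sum.inl (C.output (Sum.inr y)) := fun h =>
  Sum.inl_ne_inr (C.output_injective (Sum.inl_injective h))

variable {C}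

/-! #### Acyclicity -/

/-- Old gates are accessible (acyclicity of `C`). [cite: DawarWilsenach2025, Def. 2.2] -/
theorem acc_inl (g : G) : Acc (fun a b : G ⊕ Y => a ∈ hadChildren C b) (.inl g) := by
  induction g using C.wf.induction with
  | h g ih =>
    refine Acc.intro _ fun a ha => ?_
    simp only [hadChildren, Finset.mem_map, Function.Embedding.inl_apply] at ha
    obtain ⟨h, hh, rfl⟩ := ha
    exact ih h hh

/-- New gates are accessible (their children are old gates). [cite: DawarWilsenach2025, Def. 2.2] -/
theorem acc_inr (y : Y) : Acc (fun a b : G ⊕ Y => a ∈ hadChildren C b) (.inr y) := by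
  refine Acc.intro _ fun a ha => ?_
  simp only [hadChildren, Finset.mem_insert, Finset.mem_singleton] at ha
  rcases ha with rfl | rfl
  · exact acc_inl _
  · exact acc_inl _

/-- The child relation of the Hadamard circuit is well founded.
[cite: DawarWilsenach2025, Def. 2.2] -/
theorem hadChildren_wf : WellFounded fun a b : G ⊕ Y => a ∈ hadChildren C b :=
  ⟨fun a => match a with
    | .inl g => acc_inl g
    | .inr y => acc_inr y⟩

/-! #### The labelled circuit -/

/-- Input labels exactly at the gates without children. [cite: DawarWilsenach2025, Def. 2.2] -/
theorem isInput_iff (a : G ⊕ Y) : (hadLabel C a).IsInput ↔ hadChildren C a = ∅ := by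
  cases a with
  | inl g => simp only [hadLabel, hadChildren, Finset.map_eq_empty]; exact C.isInput_iff g
  | inr y => simp [hadLabel, hadChildren]

/-- Labels are injective on input gates: all input gates are old gates, on which this is the
corresponding clause for `C`. [cite: DawarWilsenach2025, Def. 2.2] -/
theorem eq_of_label_eq (a b : G ⊕ Y) (ha : (hadLabel C a).IsInput)
    (hab : hadLabel C a = hadLabel C b) : a = b := by
  cases a with
  | inl g =>
    rw [hadLabel_inl] at ha hab
    cases b with
    | inl g' => exact congrArg Sum.inl (C.eq_of_label_eq g g' ha hab)
    | inr y =>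
      rw [hadLabel_inr] at hab
      rw [hab] at ha
      exact absurd ha (by simp)
  | inr y =>
    rw [hadLabel_inr] at ha
    exact absurd ha (by simp)

variable (C)

/-- **The Hadamard circuit** over `C` (module docstring): gate set `G ⊕ Y`, the old gates with
their labels and wires, and one new product gate `Sum.inr y = out (Sum.inl y) × out (Sum.inr y)`
per index `y`, which is the output gate indexed `y`. [cite: DawarWilsenach2025, Def. 2.2] -/
def hadCircuit : LabelledArithCircuit K X Y (G ⊕ Y) where
  children := hadChildren C
  label := hadLabel C
  output := Sum.inr
  wf := hadChildren_wf
  isInput_iff := isInput_iff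
  eq_of_label_eq := eq_of_label_eq
  output_injective := Sum.inr_injective

variable {C}

/-! ### Semantics -/

section Eval

variable [CommSemiring K]

/-- Old gates keep their values. [cite: DawarWilsenach2025, §2 (evaluation)] -/
theorem eval_inl (g : G) : (hadCircuit C).eval (.inl g) = C.eval g := by
  induction g using C.wf.induction with
  | h g ih =>
    have hlab : (hadCircuit C).label (.inl g) = C.label g := rfl
    have hch : (hadCircuit C).children (.inl g) = (C.children g).map Function.Embedding.inl := rfl
    rcases hl : C.label g with x | c | _ | _
    · rw [C.eval_of_label_var hl, (hadCircuit C).eval_of_label_var (hlab.trans hl)]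
    · rw [C.eval_of_label_const hl, (hadCircuit C).eval_of_label_const (hlab.trans hl)]
    · rw [C.eval_of_label_add hl, (hadCircuit C).eval_of_label_add (hlab.trans hl), hch,
        Finset.sum_map]
      exact Finset.sum_congr rfl fun h hh => ih h hh
    · rw [C.eval_of_label_mul hl, (hadCircuit C).eval_of_label_mul (hlab.trans hl), hch,
        Finset.prod_map]
      exact Finset.prod_congr rfl fun h hh => ih h hh

/-- A new gate computes the product of the values of `C` at its outputs indexed `Sum.inl y` and
`Sum.inr y` (a binary product: the two children are distinct).
[cite: DawarWilsenach2025, §2 (evaluation)] -/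
theorem eval_inr (y : Y) :
    (hadCircuit C).eval (.inr y) =
      C.eval (C.output (Sum.inl y)) * C.eval (C.output (Sum.inr y)) := by
  rw [(hadCircuit C).eval_of_label_mul (show (hadCircuit C).label (.inr y) = .mul from rfl)]
  change ∏ h ∈ ({Sum.inl (C.output (Sum.inl y)), Sum.inl (C.output (Sum.inr y))} :
    Finset (G ⊕ Y)), (hadCircuit C).eval h = _
  rw [Finset.prod_pair (inl_output_inl_ne C y), eval_inl, eval_inl]

/-- **Semantics.** The output indexed `y` computes the product of the outputs of `C` indexed
`Sum.inl y` and `Sum.inr y`: the Hadamard product of the two output families.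
[cite: DawarWilsenach2025, §2 (evaluation)] -/
theorem eval_output (y : Y) :
    (hadCircuit C).eval ((hadCircuit C).output y) =
      C.eval (C.output (Sum.inl y)) * C.eval (C.output (Sum.inr y)) :=
  eval_inr y

end Eval

/-! ### Symmetry -/

section Symmetry

variable {Γ : Type*} [Group Γ] [MulAction Γ X] [MulAction Γ Y] {γ : Γ} {π : Equiv.Perm G}

/-- **Symmetry.** If `π` is an automorphism of `C` extending `γ` (for the sum action of `Γ` on
the output indices `Y ⊕ Y`) then `π ⊕ (γ • ·)` is an automorphism of the Hadamard circuit
extending `γ`: the output gates `out (Sum.inl y)`, `out (Sum.inr y)` go to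
`out (Sum.inl (γ • y))`, `out (Sum.inr (γ • y))`, so the children of the new gate `y` go to
those of the new gate `γ • y`.
[cite: DawarWilsenach2025, Def. 3.6] -/
theorem isAutomorphismExtending_sumCongr (hπ : C.IsAutomorphismExtending γ π) :
    (hadCircuit C).IsAutomorphismExtending γ (Equiv.sumCongr π (MulAction.toPerm γ)) := by
  refine ⟨?_, ?_, fun _ => rfl⟩
  · rintro (g | y)
    · change hadChildren C (.inl (π g)) =
        (hadChildren C (.inl g)).map (Equiv.sumCongr π (MulAction.toPerm γ)).toEmbedding
      rw [hadChildren_inl, hadChildren_inl, hπ.children_apply, Finset.map_map, Finset.map_map]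
      rfl
    · change hadChildren C (.inr (γ • y)) =
        (hadChildren C (.inr y)).map (Equiv.sumCongr π (MulAction.toPerm γ)).toEmbedding
      have h₁ : C.output (Sum.inl (γ • y)) = π (C.output (Sum.inl y)) := by
        rw [← hπ.output_smul, Sum.smul_inl]
      have h₂ : C.output (Sum.inr (γ • y)) = π (C.output (Sum.inr y)) := by
        rw [← hπ.output_smul, Sum.smul_inr]
      rw [hadChildren_inr, hadChildren_inr, Finset.map_insert, Finset.map_singleton, h₁, h₂]
      rfl
  · rintro (g | y)
    · exact hπ.label_apply g
    · rfl

/-- A `Γ`-symmetric `C` gives a `Γ`-symmetric Hadamard circuit (Def. 3.7).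
[cite: DawarWilsenach2025, Def. 3.7] -/
theorem isSymmetric (hC : C.IsSymmetric Γ) : (hadCircuit C).IsSymmetric Γ := by
  intro γ
  obtain ⟨π, hπ⟩ := hC γ
  exact ⟨Equiv.sumCongr π (MulAction.toPerm γ), isAutomorphismExtending_sumCongr hπ⟩

end Symmetry

end Hadamard

/-- **Hadamard products of symmetrically computed families.** For any group `Γ` acting on the
variables `X` and on the index set `Y`: if a `Γ`-symmetric labelled circuit `C` over `K`, `X`
computes two families at outputs indexed by `Y ⊕ Y` (sum action), then some `Γ`-symmetric
labelled circuit with outputs indexed by `Y` computes at `y` the product of the values of `C` at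
`Sum.inl y` and `Sum.inr y`, on at most `|G| + |Y|` gates (Dawar–Wilsenach Defs. 2.2, 3.6, 3.7;
the construction is `Hadamard.hadCircuit`, one product gate per index, and the size is
`Fintype.card_sum`). [cite: DawarWilsenach2025, Def. 3.7] -/
theorem IsSymmetric.exists_hadamard {K : Type u} [CommSemiring K] {X : Type v} {Y : Type z}
    [Fintype Y] {G : Type w} [Fintype G] {Γ : Type*} [Group Γ] [MulAction Γ X] [MulAction Γ Y]
    {C : LabelledArithCircuit K X (Y ⊕ Y) G} (hC : C.IsSymmetric Γ) :
    ∃ (G' : Type (max w z)) (_ : Fintype G') (C' : LabelledArithCircuit K X Y G'),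
      C'.IsSymmetric Γ ∧
      (∀ y, C'.eval (C'.output y) =
        C.eval (C.output (Sum.inl y)) * C.eval (C.output (Sum.inr y))) ∧
      Fintype.card G' ≤ Fintype.card G + Fintype.card Y :=
  ⟨G ⊕ Y, inferInstance, Hadamard.hadCircuit C, Hadamard.isSymmetric hC, Hadamard.eval_output,
    Fintype.card_sum.le⟩

end LabelledArithCircuit

end Literature.Computability.AlgebraicComplexity

end
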